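import Summits.CriticalPhenomena.PercolationContinuityZ3.Theorems.PercNearOneGluingNoHeavyLowerTailIncStarTwoPortBranchLemma
import Summits.CriticalPhenomena.PercolationContinuityZ3.Theorems.PercNearOneGluingNoHeavyLowerTailCILScaledReferenceTools
import Summits.CriticalPhenomena.PercolationContinuityZ3.Theorems.PercNearOneGluingAdditiveGluingTieLiftOne
import HarnessLib

/-!
# CONJECTURE Θ₂ and CONJECTURE B-cyc are theorems: `E₃` of the increasing star is concave along EVERY pair whose deletion leaves an
# acyclic environment

Support file for the Sahi programme (`--supports stmt-CriticalPhenomena-4575`, prover prim-sahi-p2 gen 21).  No definitions, no named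
facts, no sorries; standard axioms.  Memo `run/shared/lean/prim/prim-sahi/prim-sahi-p2/gen21/THEOREM-H.md` §2–§3, `PROOF-E3.md` §31.

Product Bernoulli percolation `prodBernoulli w` on the pairs of `Fin n`, root `s`, a pair `e = s(u, v)` (`u ≠ v`, `v ≠ s`; `u = s` — a root
pair — allowed), `P₀ = prodBernoulli w[e↦0]`, `P₁ = prodBernoulli w[e↦1]`, root-connection events `B = {s↔b}`, `C = {s↔c}`.
* `theta_twoPort_nonneg` — **CONJECTURE Θ₂ of p2 gen 20 (PROOF-E3 (30l))**, in the form
  `(P₁B − P₀B)·P₁C + (P₁C − P₀C)·P₁B ≤ 2·(P₁(B∩C) − P₀(B∩C))`, whenever the environment of `w[e↦0]` is acyclic.  Proof: `P₁(X) = P₀(ω⁺ ∈ X)`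
  (`tieLiftOne_real_one_eq`), `{ω⁺ ∈ B} = B ⊔ U_b ⊔ V_b` with the two-port events `U_b = {s↔u} ∩ {s↔v}ᶜ ∩ {b↔v}`, `V_b` (ports
  exchanged), and four instances of the two-port branch lemma `IncStar.twoPortBranchLemma`.
* `pairCubic_threePoint_real` — pure real arithmetic: the cubic `q ↦ E₃` built from the affine one-bond interpolations of the seven moments
  is concave on `[0,1]` as soon as the three `Θ₂`-inequalities hold and the three single slopes are `≥ 0`
  (three-point defect `= (p−p₀)(p₁−p)(p₁−p₀)[V₀(3−Σp) + V₁Σp]/3`, `V₁ = ½Σ_cyc δ_A T_{BC}`, `V₀ = V₁ + 3δ_Aδ_Bδ_C`).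
* **`incStar_pair_threePoint_of_acyclic`** — for every pair `e` (non-diagonal) such that the environment of `w[e↦0]` is acyclic, ALL
  targets `a, b, c` and `0 ≤ p₀ ≤ p ≤ p₁ ≤ 1`:
  `(p₁ − p)·E₃(w[e↦p₀]) + (p − p₀)·E₃(w[e↦p₁]) ≤ (p₁ − p₀)·E₃(w[e↦p])` for `E₃ = E₃({s↔a},{s↔b},{s↔c})`.
  This contains THEOREM FC (`e` a root pair or a forest edge of an apex-forest: `…IncStarApexForestConcave`) AND CONJECTURE B-cyc of p2
  gen 18 (`e` closing a cycle of the forest), with one uniform proof; `incStar_pair_chord_of_acyclic` is the chord form.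
-/

noncomputable section

namespace Summit.CriticalPhenomena.PercolationContinuityZ3.Theorems

namespace IncStar

open MeasureTheory Set Literature.Probability.Percolation Literature.Probability.LatticeModels EdgeInduction
open scoped Classical

variable {n : ℕ}

/-- Splitting a probability along a three-block partition. [folklore] -/
theorem real_inter_split3 (μ : Measure (BondConfig (Fin n))) [IsFiniteMeasure μ] {X A₁ A₂ A₃ : Set (BondConfig (Fin n))}
    (hX : ∀ ω, ω ∈ X ↔ ω ∈ A₁ ∨ ω ∈ A₂ ∨ ω ∈ A₃) (h12 : ∀ ω, ω ∈ A₁ → ω ∉ A₂) (h13 : ∀ ω, ω ∈ A₁ → ω ∉ A₃)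
    (h23 : ∀ ω, ω ∈ A₂ → ω ∉ A₃) (Y : Set (BondConfig (Fin n))) :
    μ.real (X ∩ Y) = μ.real (A₁ ∩ Y) + μ.real (A₂ ∩ Y) + μ.real (A₃ ∩ Y) := by
  have hm : ∀ Z : Set (BondConfig (Fin n)), MeasurableSet Z := fun _ => MeasurableSet.of_discrete
  have e1 : X ∩ Y = (A₁ ∩ Y ∪ A₂ ∩ Y) ∪ A₃ ∩ Y := by
    ext ω; simp only [Set.mem_inter_iff, Set.mem_union, hX ω]; tauto
  rw [e1, measureReal_union _ (hm _), measureReal_union _ (hm _)]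
  · exact Set.disjoint_left.2 fun ω h1 h2 => h12 ω h1.1 h2.1
  · refine Set.disjoint_left.2 fun ω h h3 => ?_
    rcases h with h | h
    · exact h13 ω h.1 h3.1
    · exact h23 ω h.1 h3.1

/-- One half of `Θ₂`: the contribution of the `u`-rooted pivotal event `U_b` (an instance of the two-port branch lemma), in the form
`P₀(U_b)·P₀(ω⁺ ∈ C) ≤ P₀(U_b ∩ {ω⁺ ∈ C}) + P₀(U_b ∩ C)`. [this work] -/
theorem theta_twoPort_half (w : Sym2 (Fin n) → unitInterval) {s u v : Fin n} (b c : Fin n) (hvs : v ≠ s)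
    (hv : ∀ ⦃x : Fin n⦄, (SimpleGraph.fromEdgeSet {z : Sym2 (Fin n) | s ∉ z ∧ w z ≠ 0}).Reachable v x →
      ∀ (p : (SimpleGraph.fromEdgeSet {z : Sym2 (Fin n) | s ∉ z ∧ w z ≠ 0}).Walk x x), ¬ p.IsCycle) :
    (prodBernoulli w).real (openConn s u ∩ (openConn s v)ᶜ ∩ openConn b v) *
        (prodBernoulli w).real ((fun ω : BondConfig (Fin n) => insert s(u, v) ω) ⁻¹' openConn s c)
      ≤ (prodBernoulli w).real (openConn s u ∩ (openConn s v)ᶜ ∩ openConn b v ∩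
            ((fun ω : BondConfig (Fin n) => insert s(u, v) ω) ⁻¹' openConn s c))
        + (prodBernoulli w).real (openConn s u ∩ (openConn s v)ᶜ ∩ openConn b v ∩ openConn s c) := by
  have H := twoPortBranchLemma_local w u v b c hvs hv
  have hsub : ((fun ω : BondConfig (Fin n) => insert s(u, v) ω) ⁻¹' openConn s c : Set (BondConfig (Fin n)))
      ⊆ openConn s c ∪ openConn u c ∪ openConn v c := by
    intro ω hω
    rw [Set.mem_preimage, insert_pair_mem_openConn_iff] at hω
    simp only [Set.mem_union]
    tauto
  have e1 : openConn s u ∩ (openConn s v)ᶜ ∩ openConn b v ∩ (openConn s c ∪ openConn u c ∪ openConn v c)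
      = openConn s u ∩ (openConn s v)ᶜ ∩ openConn b v ∩ ((fun ω : BondConfig (Fin n) => insert s(u, v) ω) ⁻¹' openConn s c) := by
    ext ω
    simp only [Set.mem_inter_iff, Set.mem_compl_iff, Set.mem_union, Set.mem_preimage, insert_pair_mem_openConn_iff]
    tauto
  have e2 : openConn s u ∩ (openConn s v)ᶜ ∩ openConn b v ∩ (openConn s c ∪ openConn u c)
      = openConn s u ∩ (openConn s v)ᶜ ∩ openConn b v ∩ openConn s c := by
    ext ω
    simp only [Set.mem_inter_iff, Set.mem_compl_iff, Set.mem_union]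
    constructor
    · rintro ⟨hU, hX⟩
      refine ⟨hU, hX.elim id fun huc => ?_⟩
      exact SimpleGraph.Reachable.trans hU.1.1 huc
    · rintro ⟨hU, hX⟩; exact ⟨hU, Or.inl hX⟩
  rw [e1, e2] at H
  exact le_trans (mul_le_mul_of_nonneg_left (measureReal_mono hsub (measure_ne_top _ _)) measureReal_nonneg) H

/-- `Θ₂`, local form: `Θ_e(B,C) ≥ 0` as soon as no cycle of the environment of `w[e↦0]` passes through the components of the two
endpoints of `e` (cycles elsewhere allowed). [this work] -/
theorem theta_twoPort_nonneg_local (w : Sym2 (Fin n) → unitInterval) {s u v : Fin n} (b c : Fin n) (hvs : v ≠ s)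
    (hv : ∀ ⦃x : Fin n⦄, (SimpleGraph.fromEdgeSet {z : Sym2 (Fin n) | s ∉ z ∧ Function.update w s(u, v) 0 z ≠ 0}).Reachable v x →
      ∀ (p : (SimpleGraph.fromEdgeSet {z : Sym2 (Fin n) | s ∉ z ∧ Function.update w s(u, v) 0 z ≠ 0}).Walk x x), ¬ p.IsCycle)
    (hu : u ≠ s → ∀ ⦃x : Fin n⦄, (SimpleGraph.fromEdgeSet {z : Sym2 (Fin n) | s ∉ z ∧ Function.update w s(u, v) 0 z ≠ 0}).Reachable u x →
      ∀ (p : (SimpleGraph.fromEdgeSet {z : Sym2 (Fin n) | s ∉ z ∧ Function.update w s(u, v) 0 z ≠ 0}).Walk x x), ¬ p.IsCycle) :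
    ((prodBernoulli (Function.update w s(u, v) 1)).real (openConn s b) - (prodBernoulli (Function.update w s(u, v) 0)).real (openConn s b))
        * (prodBernoulli (Function.update w s(u, v) 1)).real (openConn s c)
      + ((prodBernoulli (Function.update w s(u, v) 1)).real (openConn s c)
          - (prodBernoulli (Function.update w s(u, v) 0)).real (openConn s c))
        * (prodBernoulli (Function.update w s(u, v) 1)).real (openConn s b)
      ≤ 2 * ((prodBernoulli (Function.update w s(u, v) 1)).real (openConn s b ∩ openConn s c)
          - (prodBernoulli (Function.update w s(u, v) 0)).real (openConn s b ∩ openConn s c)) := by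
  have lift : ∀ A : Set (BondConfig (Fin n)), (prodBernoulli (Function.update w s(u, v) 1)).real A
      = (prodBernoulli (Function.update w s(u, v) 0)).real ((fun ω : BondConfig (Fin n) => insert s(u, v) ω) ⁻¹' A) :=
    fun A => tieLiftOne_real_one_eq w s(u, v) A
  rw [lift, lift, lift (openConn s b ∩ openConn s c), Set.preimage_inter]
  set w0 := Function.update w s(u, v) 0 with hw0
  set P := prodBernoulli w0 with hP
  set B : Set (BondConfig (Fin n)) := openConn s b with hBdef
  set C : Set (BondConfig (Fin n)) := openConn s c with hCdef
  set LB : Set (BondConfig (Fin n)) := (fun ω : BondConfig (Fin n) => insert s(u, v) ω) ⁻¹' openConn s b with hLB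
  set LC : Set (BondConfig (Fin n)) := (fun ω : BondConfig (Fin n) => insert s(u, v) ω) ⁻¹' openConn s c with hLC
  set Ub : Set (BondConfig (Fin n)) := openConn s u ∩ (openConn s v)ᶜ ∩ openConn b v with hUb
  set Vb : Set (BondConfig (Fin n)) := openConn s v ∩ (openConn s u)ᶜ ∩ openConn b u with hVb
  set Uc : Set (BondConfig (Fin n)) := openConn s u ∩ (openConn s v)ᶜ ∩ openConn c v with hUc
  set Vc : Set (BondConfig (Fin n)) := openConn s v ∩ (openConn s u)ᶜ ∩ openConn c u with hVc
  -- the partition `{ω⁺ ∈ T} = T ⊔ U_t ⊔ V_t`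
  have part : ∀ t : Fin n, ∀ ω : BondConfig (Fin n),
      ω ∈ (fun ω : BondConfig (Fin n) => insert s(u, v) ω) ⁻¹' openConn s t ↔
        ω ∈ openConn s t ∨ ω ∈ openConn s u ∩ (openConn s v)ᶜ ∩ openConn t v ∨ ω ∈ openConn s v ∩ (openConn s u)ᶜ ∩ openConn t u := by
    clear hv hu
    intro t ω
    rw [Set.mem_preimage, insert_pair_mem_openConn_iff]
    simp only [Set.mem_inter_iff, Set.mem_compl_iff]
    have h1 : ω ∈ openConn s u → ω ∈ openConn u t → ω ∈ openConn s t := fun h h' => SimpleGraph.Reachable.trans h h'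
    have h2 : ω ∈ openConn s v → ω ∈ openConn v t → ω ∈ openConn s t := fun h h' => SimpleGraph.Reachable.trans h h'
    have h3 : ω ∈ openConn t v ↔ ω ∈ openConn v t := ⟨fun h => SimpleGraph.Reachable.symm h, fun h => SimpleGraph.Reachable.symm h⟩
    have h4 : ω ∈ openConn t u ↔ ω ∈ openConn u t := ⟨fun h => SimpleGraph.Reachable.symm h, fun h => SimpleGraph.Reachable.symm h⟩
    tauto
  have d12 : ∀ t : Fin n, ∀ ω : BondConfig (Fin n), ω ∈ openConn s t → ω ∉ openConn s u ∩ (openConn s v)ᶜ ∩ openConn t v :=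
    fun t ω h hU => hU.1.2 (SimpleGraph.Reachable.trans h hU.2)
  have d13 : ∀ t : Fin n, ∀ ω : BondConfig (Fin n), ω ∈ openConn s t → ω ∉ openConn s v ∩ (openConn s u)ᶜ ∩ openConn t u :=
    fun t ω h hV => hV.1.2 (SimpleGraph.Reachable.trans h hV.2)
  have d23 : ∀ t : Fin n, ∀ ω : BondConfig (Fin n),
      ω ∈ openConn s u ∩ (openConn s v)ᶜ ∩ openConn t v → ω ∉ openConn s v ∩ (openConn s u)ᶜ ∩ openConn t u :=
    fun t ω hU hV => hV.1.2 hU.1.1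
  -- the splittings
  have sB : P.real LB = P.real B + P.real Ub + P.real Vb := by
    have h := real_inter_split3 P (part b) (d12 b) (d13 b) (d23 b) Set.univ
    simpa only [Set.inter_univ] using h
  have sC : P.real LC = P.real C + P.real Uc + P.real Vc := by
    have h := real_inter_split3 P (part c) (d12 c) (d13 c) (d23 c) Set.univ
    simpa only [Set.inter_univ] using h
  have g1 : P.real (LB ∩ LC) = P.real (B ∩ LC) + P.real (Ub ∩ LC) + P.real (Vb ∩ LC) :=
    real_inter_split3 P (part b) (d12 b) (d13 b) (d23 b) LC
  have g2 : P.real (LC ∩ B) = P.real (C ∩ B) + P.real (Uc ∩ B) + P.real (Vc ∩ B) :=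
    real_inter_split3 P (part c) (d12 c) (d13 c) (d23 c) B
  have g3 : P.real (LC ∩ LB) = P.real (C ∩ LB) + P.real (Uc ∩ LB) + P.real (Vc ∩ LB) :=
    real_inter_split3 P (part c) (d12 c) (d13 c) (d23 c) LB
  have g4 : P.real (LB ∩ C) = P.real (B ∩ C) + P.real (Ub ∩ C) + P.real (Vb ∩ C) :=
    real_inter_split3 P (part b) (d12 b) (d13 b) (d23 b) C
  have c1 : P.real (LC ∩ B) = P.real (B ∩ LC) := by rw [Set.inter_comm]
  have c2 : P.real (LC ∩ LB) = P.real (LB ∩ LC) := by rw [Set.inter_comm]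
  have c3 : P.real (C ∩ LB) = P.real (LB ∩ C) := by rw [Set.inter_comm]
  have c4 : P.real (C ∩ B) = P.real (B ∩ C) := by rw [Set.inter_comm]
  -- the four two-port instances
  have hU_b : P.real Ub * P.real LC ≤ P.real (Ub ∩ LC) + P.real (Ub ∩ C) := theta_twoPort_half w0 b c hvs hv
  have hU_c : P.real Uc * P.real LB ≤ P.real (Uc ∩ LB) + P.real (Uc ∩ B) := theta_twoPort_half w0 c b hvs hv
  have hswap : s(v, u) = s(u, v) := Sym2.eq_swap
  have hV_b : P.real Vb * P.real LC ≤ P.real (Vb ∩ LC) + P.real (Vb ∩ C) := by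
    by_cases hus : u = s
    · have h0 : P.real Vb = 0 := by
        have hVe : Vb = ∅ := by
          refine Set.eq_empty_of_forall_notMem fun ω hω => ?_
          rw [hVb] at hω
          exact hω.1.2 (hus ▸ (SimpleGraph.Reachable.refl u : ω ∈ openConn u u))
        rw [hVe, measureReal_empty]
      rw [h0, zero_mul]
      exact add_nonneg measureReal_nonneg measureReal_nonneg
    · have h := theta_twoPort_half w0 b c hus (hu hus) (u := v) (v := u)
      rw [hswap] at h
      exact h
  have hV_c : P.real Vc * P.real LB ≤ P.real (Vc ∩ LB) + P.real (Vc ∩ B) := by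
    by_cases hus : u = s
    · have h0 : P.real Vc = 0 := by
        have hVe : Vc = ∅ := by
          refine Set.eq_empty_of_forall_notMem fun ω hω => ?_
          rw [hVc] at hω
          exact hω.1.2 (hus ▸ (SimpleGraph.Reachable.refl u : ω ∈ openConn u u))
        rw [hVe, measureReal_empty]
      rw [h0, zero_mul]
      exact add_nonneg measureReal_nonneg measureReal_nonneg
    · have h := theta_twoPort_half w0 c b hus (hu hus) (u := v) (v := u)
      rw [hswap] at h
      exact h
  -- assemble (linear arithmetic only)
  have eq1 : P.real LB - P.real B = P.real Ub + P.real Vb := by linarith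
  have eq2 : P.real LC - P.real C = P.real Uc + P.real Vc := by linarith
  rw [eq1, eq2]
  have rhs : 2 * (P.real (LB ∩ LC) - P.real (B ∩ C))
      = (P.real (Ub ∩ LC) + P.real (Ub ∩ C)) + (P.real (Vb ∩ LC) + P.real (Vb ∩ C))
        + ((P.real (Uc ∩ LB) + P.real (Uc ∩ B)) + (P.real (Vc ∩ LB) + P.real (Vc ∩ B))) := by
    linarith
  have expand : (P.real Ub + P.real Vb) * P.real LC + (P.real Uc + P.real Vc) * P.real LB
      = (P.real Ub * P.real LC + P.real Vb * P.real LC) + (P.real Uc * P.real LB + P.real Vc * P.real LB) := by ring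
  rw [rhs, expand]
  exact add_le_add (add_le_add hU_b hV_b) (add_le_add hU_c hV_c)

/-- **CONJECTURE Θ₂ (p2 gen 20) is a theorem**: for every pair `e = s(u,v)` (`v ≠ s`) whose deletion leaves an acyclic
environment, `δ_B·P₁(C) + δ_C·P₁(B) ≤ 2·δ_{B∩C}` (`δ_X = P₁X − P₀X`, `Pᵢ = prodBernoulli w[e↦i]`), i.e. `Θ_e(B,C) ≥ 0`. [this work] -/
theorem theta_twoPort_nonneg (w : Sym2 (Fin n) → unitInterval) {s u v : Fin n} (b c : Fin n) (hvs : v ≠ s)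
    (hforest : (SimpleGraph.fromEdgeSet {z : Sym2 (Fin n) | s ∉ z ∧ Function.update w s(u, v) 0 z ≠ 0}).IsAcyclic) :
    ((prodBernoulli (Function.update w s(u, v) 1)).real (openConn s b) - (prodBernoulli (Function.update w s(u, v) 0)).real (openConn s b))
        * (prodBernoulli (Function.update w s(u, v) 1)).real (openConn s c)
      + ((prodBernoulli (Function.update w s(u, v) 1)).real (openConn s c)
          - (prodBernoulli (Function.update w s(u, v) 0)).real (openConn s c))
        * (prodBernoulli (Function.update w s(u, v) 1)).real (openConn s b)
      ≤ 2 * ((prodBernoulli (Function.update w s(u, v) 1)).real (openConn s b ∩ openConn s c)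
          - (prodBernoulli (Function.update w s(u, v) 0)).real (openConn s b ∩ openConn s c)) :=
  theta_twoPort_nonneg_local w b c hvs (fun _ _ p => hforest p) (fun _ _ _ p => hforest p)

/-- **The cubic along one pair is concave when the three `Θ₂`-inequalities hold** (pure real arithmetic): with affine interpolations
`X(q) = (1−q)mX + q·MX` of the seven moments, `f(q) = 2·ABC(q) + A(q)B(q)C(q) − Σ_cyc A(q)·BC(q)` satisfies the three-point inequality
on `[0,1]`; the defect is `(p−p₀)(p₁−p)(p₁−p₀)[V₀(3−Σp) + V₁Σp]/3`. [this work] -/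
theorem pairCubic_threePoint_real (mA MA mB MB mC MC mAB MAB mAC MAC mBC MBC mABC MABC p₀ p p₁ : ℝ)
    (hA : mA ≤ MA) (hB : mB ≤ MB) (hC : mC ≤ MC)
    (hTBC : (MB - mB) * MC + (MC - mC) * MB ≤ 2 * (MBC - mBC))
    (hTCA : (MC - mC) * MA + (MA - mA) * MC ≤ 2 * (MAC - mAC))
    (hTAB : (MA - mA) * MB + (MB - mB) * MA ≤ 2 * (MAB - mAB))
    (hp₀ : 0 ≤ p₀) (h01 : p₀ ≤ p) (h12 : p ≤ p₁) (hp₁ : p₁ ≤ 1) :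
    (p₁ - p) * (2 * ((1 - p₀) * mABC + p₀ * MABC) + ((1 - p₀) * mA + p₀ * MA) * ((1 - p₀) * mB + p₀ * MB) * ((1 - p₀) * mC + p₀ * MC)
        - (((1 - p₀) * mA + p₀ * MA) * ((1 - p₀) * mBC + p₀ * MBC) + ((1 - p₀) * mB + p₀ * MB) * ((1 - p₀) * mAC + p₀ * MAC)
          + ((1 - p₀) * mC + p₀ * MC) * ((1 - p₀) * mAB + p₀ * MAB)))
      + (p - p₀) * (2 * ((1 - p₁) * mABC + p₁ * MABC) + ((1 - p₁) * mA + p₁ * MA) * ((1 - p₁) * mB + p₁ * MB) * ((1 - p₁) * mC + p₁ * MC)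
        - (((1 - p₁) * mA + p₁ * MA) * ((1 - p₁) * mBC + p₁ * MBC) + ((1 - p₁) * mB + p₁ * MB) * ((1 - p₁) * mAC + p₁ * MAC)
          + ((1 - p₁) * mC + p₁ * MC) * ((1 - p₁) * mAB + p₁ * MAB)))
      ≤ (p₁ - p₀) * (2 * ((1 - p) * mABC + p * MABC) + ((1 - p) * mA + p * MA) * ((1 - p) * mB + p * MB) * ((1 - p) * mC + p * MC)
        - (((1 - p) * mA + p * MA) * ((1 - p) * mBC + p * MBC) + ((1 - p) * mB + p * MB) * ((1 - p) * mAC + p * MAC)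
          + ((1 - p) * mC + p * MC) * ((1 - p) * mAB + p * MAB))) := by
  rw [← sub_nonneg]
  set dA := MA - mA
  set dB := MB - mB
  set dC := MC - mC
  set V1 : ℝ := (dA * (2 * (MBC - mBC) - (dB * MC + dC * MB)) + dB * (2 * (MAC - mAC) - (dC * MA + dA * MC))
    + dC * (2 * (MAB - mAB) - (dA * MB + dB * MA))) / 2 with hV1
  have key : (p₁ - p₀) * (2 * ((1 - p) * mABC + p * MABC) + ((1 - p) * mA + p * MA) * ((1 - p) * mB + p * MB) * ((1 - p) * mC + p * MC)
        - (((1 - p) * mA + p * MA) * ((1 - p) * mBC + p * MBC) + ((1 - p) * mB + p * MB) * ((1 - p) * mAC + p * MAC)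
          + ((1 - p) * mC + p * MC) * ((1 - p) * mAB + p * MAB)))
      - ((p₁ - p) * (2 * ((1 - p₀) * mABC + p₀ * MABC) + ((1 - p₀) * mA + p₀ * MA) * ((1 - p₀) * mB + p₀ * MB) * ((1 - p₀) * mC + p₀ * MC)
        - (((1 - p₀) * mA + p₀ * MA) * ((1 - p₀) * mBC + p₀ * MBC) + ((1 - p₀) * mB + p₀ * MB) * ((1 - p₀) * mAC + p₀ * MAC)
          + ((1 - p₀) * mC + p₀ * MC) * ((1 - p₀) * mAB + p₀ * MAB)))
      + (p - p₀) * (2 * ((1 - p₁) * mABC + p₁ * MABC) + ((1 - p₁) * mA + p₁ * MA) * ((1 - p₁) * mB + p₁ * MB) * ((1 - p₁) * mC + p₁ * MC)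
        - (((1 - p₁) * mA + p₁ * MA) * ((1 - p₁) * mBC + p₁ * MBC) + ((1 - p₁) * mB + p₁ * MB) * ((1 - p₁) * mAC + p₁ * MAC)
          + ((1 - p₁) * mC + p₁ * MC) * ((1 - p₁) * mAB + p₁ * MAB))))
      = (p - p₀) * (p₁ - p) * (p₁ - p₀) * ((V1 + 3 * (dA * dB * dC)) * (3 - (p₀ + p + p₁)) + V1 * (p₀ + p + p₁)) / 3 := by
    rw [hV1]; ring
  rw [key]
  have hdA : 0 ≤ dA := by simp only [dA]; linarith
  have hdB : 0 ≤ dB := by simp only [dB]; linarith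
  have hdC : 0 ≤ dC := by simp only [dC]; linarith
  have hV : 0 ≤ V1 := by
    rw [hV1]
    have t1 : 0 ≤ dA * (2 * (MBC - mBC) - (dB * MC + dC * MB)) := mul_nonneg hdA (by linarith)
    have t2 : 0 ≤ dB * (2 * (MAC - mAC) - (dC * MA + dA * MC)) := mul_nonneg hdB (by linarith)
    have t3 : 0 ≤ dC * (2 * (MAB - mAB) - (dA * MB + dB * MA)) := mul_nonneg hdC (by linarith)
    linarith
  have hddd : 0 ≤ dA * dB * dC := mul_nonneg (mul_nonneg hdA hdB) hdC
  have hS0 : 0 ≤ p₀ + p + p₁ := by linarith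
  have hS3 : 0 ≤ 3 - (p₀ + p + p₁) := by linarith
  have hbr : 0 ≤ (V1 + 3 * (dA * dB * dC)) * (3 - (p₀ + p + p₁)) + V1 * (p₀ + p + p₁) :=
    add_nonneg (mul_nonneg (by linarith) hS3) (mul_nonneg hV hS0)
  have h3 : 0 ≤ (p - p₀) * (p₁ - p) * (p₁ - p₀) := mul_nonneg (mul_nonneg (by linarith) (by linarith)) (by linarith)
  positivity

/-- **PAIR CONCAVITY, local form**: three-point concavity of `E₃` along a non-diagonal pair `e` as soon as no cycle of the environment
of `w[e↦0]` passes through the components of the endpoints of `e` (cycles in other components allowed). [this work] -/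
theorem incStar_pair_threePoint_local (w : Sym2 (Fin n) → unitInterval) (s a b c : Fin n) (e : Sym2 (Fin n))
    (he : ¬ e.IsDiag)
    (hloc : ∀ y : Fin n, y ∈ e → y ≠ s → ∀ ⦃x : Fin n⦄,
      (SimpleGraph.fromEdgeSet {z : Sym2 (Fin n) | s ∉ z ∧ Function.update w e 0 z ≠ 0}).Reachable y x →
      ∀ (p : (SimpleGraph.fromEdgeSet {z : Sym2 (Fin n) | s ∉ z ∧ Function.update w e 0 z ≠ 0}).Walk x x), ¬ p.IsCycle)
    (p₀ p p₁ : unitInterval) (h01 : p₀ ≤ p) (h12 : p ≤ p₁) :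
    ((p₁ : ℝ) - (p : ℝ)) * sahiE3 (prodBernoulli (Function.update w e p₀)) (openConn s a) (openConn s b) (openConn s c)
      + ((p : ℝ) - (p₀ : ℝ)) * sahiE3 (prodBernoulli (Function.update w e p₁)) (openConn s a) (openConn s b) (openConn s c)
      ≤ ((p₁ : ℝ) - (p₀ : ℝ)) * sahiE3 (prodBernoulli (Function.update w e p)) (openConn s a) (openConn s b) (openConn s c) := by
  -- name the endpoints so that the unrooted port is not the root
  obtain ⟨u, v, hvs, rfl⟩ : ∃ u v : Fin n, v ≠ s ∧ e = s(u, v) := by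
    induction e using Sym2.ind with
    | h x y =>
      have hxy : x ≠ y := fun h => he (by rw [Sym2.mk_isDiag_iff]; exact h)
      by_cases hys : y = s
      · exact ⟨y, x, fun h => hxy (h.trans hys.symm), Sym2.eq_swap⟩
      · exact ⟨x, y, hys, rfl⟩
  -- the seven moments at the three values of the weight
  rw [sahiE3_def, sahiE3_def, sahiE3_def]
  rw [HullPort.real_update_affine w s(u, v) p₀ (openConn s a ∩ openConn s b ∩ openConn s c),
    HullPort.real_update_affine w s(u, v) p₀ (openConn s a), HullPort.real_update_affine w s(u, v) p₀ (openConn s b),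
    HullPort.real_update_affine w s(u, v) p₀ (openConn s c), HullPort.real_update_affine w s(u, v) p₀ (openConn s b ∩ openConn s c),
    HullPort.real_update_affine w s(u, v) p₀ (openConn s a ∩ openConn s c), HullPort.real_update_affine w s(u, v) p₀ (openConn s a ∩ openConn s b),
    HullPort.real_update_affine w s(u, v) p (openConn s a ∩ openConn s b ∩ openConn s c),
    HullPort.real_update_affine w s(u, v) p (openConn s a), HullPort.real_update_affine w s(u, v) p (openConn s b),
    HullPort.real_update_affine w s(u, v) p (openConn s c), HullPort.real_update_affine w s(u, v) p (openConn s b ∩ openConn s c),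
    HullPort.real_update_affine w s(u, v) p (openConn s a ∩ openConn s c), HullPort.real_update_affine w s(u, v) p (openConn s a ∩ openConn s b),
    HullPort.real_update_affine w s(u, v) p₁ (openConn s a ∩ openConn s b ∩ openConn s c),
    HullPort.real_update_affine w s(u, v) p₁ (openConn s a), HullPort.real_update_affine w s(u, v) p₁ (openConn s b),
    HullPort.real_update_affine w s(u, v) p₁ (openConn s c), HullPort.real_update_affine w s(u, v) p₁ (openConn s b ∩ openConn s c),
    HullPort.real_update_affine w s(u, v) p₁ (openConn s a ∩ openConn s c), HullPort.real_update_affine w s(u, v) p₁ (openConn s a ∩ openConn s b)]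
  have hA := tieLiftOne_real_zero_le_one w s(u, v) (isUpperSet_openConn s a)
  have hB := tieLiftOne_real_zero_le_one w s(u, v) (isUpperSet_openConn s b)
  have hC := tieLiftOne_real_zero_le_one w s(u, v) (isUpperSet_openConn s c)
  have hv := hloc v (Sym2.mem_mk_right u v) hvs
  have hu := fun hus : u ≠ s => hloc u (Sym2.mem_mk_left u v) hus
  have hTBC := theta_twoPort_nonneg_local w b c hvs hv hu
  have hTCA := theta_twoPort_nonneg_local w c a hvs hv hu
  have hTAB := theta_twoPort_nonneg_local w a b hvs hv hu
  rw [Set.inter_comm (openConn s c) (openConn s a)] at hTCA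
  exact pairCubic_threePoint_real _ _ _ _ _ _ _ _ _ _ _ _ _ _ _ _ _ hA hB hC hTBC hTCA hTAB p₀.2.1 h01 h12 p₁.2.2

/-- **PAIR CONCAVITY (⊇ THEOREM FC ∪ CONJECTURE B-cyc).**  For every non-diagonal pair `e` such that the environment of `w[e↦0]` is
acyclic, all targets `a, b, c` and `0 ≤ p₀ ≤ p ≤ p₁ ≤ 1`, the increasing star `E₃({s↔a},{s↔b},{s↔c})` is concave along `e`:
`(p₁ − p)·E₃(w[e↦p₀]) + (p − p₀)·E₃(w[e↦p₁]) ≤ (p₁ − p₀)·E₃(w[e↦p])`. [this work] -/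
theorem incStar_pair_threePoint_of_acyclic (w : Sym2 (Fin n) → unitInterval) (s a b c : Fin n) (e : Sym2 (Fin n))
    (he : ¬ e.IsDiag) (hforest : (SimpleGraph.fromEdgeSet {z : Sym2 (Fin n) | s ∉ z ∧ Function.update w e 0 z ≠ 0}).IsAcyclic)
    (p₀ p p₁ : unitInterval) (h01 : p₀ ≤ p) (h12 : p ≤ p₁) :
    ((p₁ : ℝ) - (p : ℝ)) * sahiE3 (prodBernoulli (Function.update w e p₀)) (openConn s a) (openConn s b) (openConn s c)
      + ((p : ℝ) - (p₀ : ℝ)) * sahiE3 (prodBernoulli (Function.update w e p₁)) (openConn s a) (openConn s b) (openConn s c)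
      ≤ ((p₁ : ℝ) - (p₀ : ℝ)) * sahiE3 (prodBernoulli (Function.update w e p)) (openConn s a) (openConn s b) (openConn s c) :=
  incStar_pair_threePoint_local w s a b c e he (fun _ _ _ _ _ q => hforest q) p₀ p p₁ h01 h12

/-- **Chord form**: under the same hypothesis, `(1 − w e)·E₃(w[e↦0]) + (w e)·E₃(w[e↦1]) ≤ E₃(w)`. [this work] -/
theorem incStar_pair_chord_of_acyclic (w : Sym2 (Fin n) → unitInterval) (s a b c : Fin n) (e : Sym2 (Fin n))
    (he : ¬ e.IsDiag) (hforest : (SimpleGraph.fromEdgeSet {z : Sym2 (Fin n) | s ∉ z ∧ Function.update w e 0 z ≠ 0}).IsAcyclic) :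
    (1 - (w e : ℝ)) * sahiE3 (prodBernoulli (Function.update w e 0)) (openConn s a) (openConn s b) (openConn s c)
      + (w e : ℝ) * sahiE3 (prodBernoulli (Function.update w e 1)) (openConn s a) (openConn s b) (openConn s c)
      ≤ sahiE3 (prodBernoulli w) (openConn s a) (openConn s b) (openConn s c) := by
  have h := incStar_pair_threePoint_of_acyclic w s a b c e he hforest 0 (w e) 1 (w e).2.1 (w e).2.2
  rw [Function.update_eq_self] at h
  simpa using h

end IncStar

end Summit.CriticalPhenomena.PercolationContinuityZ3.Theorems
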